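import Literature.Barriers.RiemannHypothesis.TuranPartialSumsShiftBlocks
import Literature.Barriers.RiemannHypothesis.TuranPartialSumsShiftTheta
import HarnessLib

/-!
# Sections of `ζ` beyond `σ = 1`: the vertical-shift construction — analytic bounds for `B` and `R`

Barrier catalogue `Literature/Barriers/RiemannHypothesis/`, companion of `TuranPartialSums.lean`
(fifth layer of the "vertical shift" proof of `TuranPartialSums` for large `N`). Everything is
PROVED. With `X = 29/4`, `L = log N`, `τ = X/L`, `s = 1 + iτ`, `M = ⌊√N⌋`, `S(m) = ∑_{k≤m} k^{-s}`
and `T` the primes in `(M, N]`, the two quantities of the `σ = 1` criterion for the phases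
`ω(p) = p^{-iτ}` (`p ≤ M`) are

  `B(N) = S(N) − ∑_{p ∈ T} p^{-s} S(N/p)`   (`Bval`),   `R(N) = ∑_{p ∈ T} ‖S(N/p)‖/p`   (`Rval`)

(their identification with `smoothSum` / `∑ ‖bigCoeff‖` of `TuranPartialSumsCriterion.lean` is in
the assembly file). This file proves, for every `N ≥ 360000`,

  `‖B(N)‖ ≤ ‖mainB N‖ + tinyB N + deltaB N + bdry N + Jsum N + errIntB N`   (`norm_Bval_le`),
  `R(N) ≥ mainR N − deltaR N − bdry N − Jsum N − errIntR N`                  (`Rval_ge`),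

where every term on the right is an explicit real number or an explicit integral over
`u = log t/L ∈ [u_M, 1]` of a step function of `S(N/⌈N^u⌉)` (`mainB`, `mainR`) or `S(N/⌊N^u⌋)`
(`errIntB`, `errIntR`) against elementary weights and the envelope `thetaEnv` of
`TuranPartialSumsShiftTheta.lean` — the input format of the verified checker.

## The chain (all lemmas below)

prime sums → integer sums (`sum_primes_mul_log_eq`, error `primeSumErr` bounded through the
envelope: boundary terms `bdry`, jump part `Jsum` via `sum_jumps_le`, smooth part `errInt*` via
`sum_mul_le_integral_of_le`) → integrals of step functions in `t` (`norm_sum_sub_integral_stepC_le`,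
loss `delta*`) → the same integrals in `u` (`integral_comp_exp_mul`) → `S(N)` by Euler–Maclaurin
(`powSum_eq_powInt_add`, loss `tinyB`).

## References

* Only the tree's own layers `TuranPartialSumsShift{EM,Abel,Theta,Blocks}.lean`. [folklore]
-/

noncomputable section

open Real Complex Set MeasureTheory intervalIntegral Finset Filter Topology
open scoped Chebyshev

namespace Literature.Barriers.RiemannHypothesis

namespace TuranShift

/-! ## Parameters -/

/-- The fixed frequency parameter `X = τ log N = 29/4` of the construction. [folklore] -/
def shiftX : ℝ := 29 / 4

/-- `τ = τ(N) = X / log N`. [folklore] -/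
def tauN (N : ℕ) : ℝ := shiftX / Real.log N

/-- `s = s(N) = 1 + iτ`. [folklore] -/
def sN (N : ℕ) : ℂ := 1 + tauN N * I

/-- The free primes `T = {p prime : ⌊√N⌋ < p ≤ N}`. [folklore] -/
def bigPrimes (N : ℕ) : Finset ℕ := (Finset.Ioc (Nat.sqrt N) N).filter Nat.Prime

/-- `B(N) = S(N) − ∑_{p ∈ T} p^{-s} S(N/p)` (the smooth sum of the criterion for the phases
`p^{-iτ}`, in analytic form). [folklore] -/
def Bval (N : ℕ) : ℂ :=
  powSum (sN N) N - ∑ p ∈ bigPrimes N, npow (sN N) p * powSum (sN N) (N / p)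

/-- `R(N) = ∑_{p ∈ T} ‖S(N/p)‖/p` (the sum of the moduli of the big coefficients). [folklore] -/
def Rval (N : ℕ) : ℝ := ∑ p ∈ bigPrimes N, ‖powSum (sN N) (N / p)‖ / p

/-! ## Elementary facts about the parameters (`N ≥ 360000`) -/

/-- `Re s = 1`. [folklore] -/
theorem sN_re (N : ℕ) : (sN N).re = 1 := by simp [sN]

/-- `s − 1 = iτ`. [folklore] -/
theorem sN_sub_one (N : ℕ) : sN N - 1 = tauN N * I := by simp [sN]

/-- `s = 1 + iτ` (unfolding). [folklore] -/
theorem sN_def (N : ℕ) : sN N = 1 + tauN N * I := rfl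

section Params

variable {N : ℕ} (hN : 360000 ≤ N)
include hN

/-- `600 ≤ ⌊√N⌋`. [folklore] -/
theorem sqrt_ge : 600 ≤ Nat.sqrt N := by
  rw [Nat.le_sqrt]; omega

/-- `⌊√N⌋ < N`. [folklore] -/
theorem sqrt_lt : Nat.sqrt N < N := Nat.sqrt_lt_self (by omega)

/-- `1 < ⌊√N⌋` as a real number. [folklore] -/
theorem one_lt_sqrtR : (1 : ℝ) < Nat.sqrt N := by
  have := sqrt_ge hN; exact_mod_cast (by omega : 1 < Nat.sqrt N)

/-- `0 < log N` (indeed `log N ≥ log 360000 > 12`). [folklore] -/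
theorem log_pos : 0 < Real.log N := Real.log_pos (by exact_mod_cast (by omega : 1 < N))

/-- `0 < τ`. [folklore] -/
theorem tauN_pos : 0 < tauN N := by
  unfold tauN shiftX; exact div_pos (by norm_num) (log_pos hN)

/-- `s ≠ 1`. [folklore] -/
theorem sN_ne_one : sN N ≠ 1 := by
  intro h
  have := congrArg Complex.im h
  simp [sN] at this
  exact (tauN_pos hN).ne' this

/-- `τ · log N = X`. [folklore] -/
theorem tauN_mul_log : tauN N * Real.log N = shiftX := by
  unfold tauN; field_simp [(log_pos hN).ne']

end Params

/-! ## The prime sums as `∑ log p · g(p)` -/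

/-- `g_B(n) = h_B(n) S(N/n)`. [folklore] -/
def gB (N : ℕ) (n : ℕ) : ℂ := hB (tauN N) n * powSum (sN N) (N / n)

/-- `g_R(n) = h_R(n) ‖S(N/n)‖`. [folklore] -/
def gR (N : ℕ) (n : ℕ) : ℂ := hR n * ((‖powSum (sN N) (N / n)‖ : ℝ) : ℂ)

/-- Membership in `bigPrimes`. [folklore] -/
theorem mem_bigPrimes {N p : ℕ} : p ∈ bigPrimes N ↔ (Nat.sqrt N < p ∧ p ≤ N) ∧ p.Prime := by
  simp [bigPrimes]

/-- `∑_{p∈T} p^{-s} S(N/p) = ∑_{p∈T} log p · g_B(p)`. [folklore] -/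
theorem sum_bigPrimes_eq_gB (N : ℕ) :
    ∑ p ∈ bigPrimes N, npow (sN N) p * powSum (sN N) (N / p) =
      ∑ p ∈ bigPrimes N, (Real.log p : ℂ) * gB N p := by
  refine Finset.sum_congr rfl fun p hp ↦ ?_
  have hpr := (mem_bigPrimes.1 hp).2
  have hlog : (Real.log p : ℂ) ≠ 0 := by
    rw [Ne, Complex.ofReal_eq_zero]
    exact (Real.log_pos (by exact_mod_cast hpr.one_lt)).ne'
  unfold gB hB sN
  field_simp

/-- `R(N) = ∑_{p∈T} log p · g_R(p)` (as complex numbers). [folklore] -/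
theorem Rval_eq_gR (N : ℕ) :
    ((Rval N : ℝ) : ℂ) = ∑ p ∈ bigPrimes N, (Real.log p : ℂ) * gR N p := by
  unfold Rval gR hR
  rw [Complex.ofReal_sum]
  refine Finset.sum_congr rfl fun p hp ↦ ?_
  have hpr := (mem_bigPrimes.1 hp).2
  have hp0 : (0 : ℝ) < p := by exact_mod_cast hpr.pos
  have hlog : 0 < Real.log p := Real.log_pos (by exact_mod_cast hpr.one_lt)
  have : (‖powSum (sN N) (N / p)‖ / p : ℝ) =
      Real.log p * ((p * Real.log p)⁻¹ * ‖powSum (sN N) (N / p)‖) := by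
    field_simp
  rw [this]
  push_cast
  ring

/-! ## The integer sums against the step integrals -/

section Delta

variable {N : ℕ} (hN : 360000 ≤ N)
include hN

omit hN in
/-- The harmonic bound on the block values beyond `√N`: `‖S(N/n)‖ ≤ 1 + log ⌊√N⌋` for `n > ⌊√N⌋`.
[folklore] -/
theorem norm_powSum_div_le_log {n : ℕ} (hn : Nat.sqrt N < n) (hnN : n ≤ N) :
    ‖powSum (sN N) (N / n)‖ ≤ 1 + Real.log (Nat.sqrt N) := by
  have h1 := norm_powSum_le_one_add_log (sN_re N) (N / n)
  have h2 : N / n ≤ Nat.sqrt N := div_le_sqrt_of_sqrt_lt hn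
  have h3 : 1 ≤ N / n := one_le_div_of_le (by omega) hnN
  have h4 : Real.log ((N / n : ℕ) : ℝ) ≤ Real.log (Nat.sqrt N) :=
    Real.log_le_log (by exact_mod_cast h3) (by exact_mod_cast h2)
  linarith

/-- `deltaB N = (1 + log M)/2 · (D_B(M) + (‖s‖/log M + 1/log² M)/M)`: the loss in passing from
`∑ g_B(n)` to `∫ h_B · stepC`. [folklore] -/
def deltaB (N : ℕ) : ℝ :=
  (1 + Real.log (Nat.sqrt N)) / 2 * (DB (tauN N) (Nat.sqrt N) +
    (‖(1 : ℂ) + tauN N * I‖ / Real.log (Nat.sqrt N) + 1 / Real.log (Nat.sqrt N) ^ 2) / Nat.sqrt N)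

/-- `deltaR N = (1 + log M)/2 · (D_R(M) + (1/log M + 1/log² M)/M)`. [folklore] -/
def deltaR (N : ℕ) : ℝ :=
  (1 + Real.log (Nat.sqrt N)) / 2 * (DR (Nat.sqrt N) +
    (1 / Real.log (Nat.sqrt N) + 1 / Real.log (Nat.sqrt N) ^ 2) / Nat.sqrt N)

/-- **`‖∑_{M<n≤N} g_B(n) − ∫_M^N h_B · stepC_S‖ ≤ deltaB N`.** [folklore] -/
theorem norm_sum_gB_sub_integral_le :
    ‖∑ n ∈ Finset.Ioc (Nat.sqrt N) N, gB N n -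
        ∫ t in ((Nat.sqrt N : ℕ) : ℝ)..N, hB (tauN N) t * stepC (powSum (sN N)) N t‖ ≤ deltaB N := by
  set M := Nat.sqrt N with hM
  have hM1 : (1 : ℝ) < M := one_lt_sqrtR hN
  have hMN : M ≤ N := (sqrt_lt hN).le
  have hderiv : ∀ t ∈ Icc (M : ℝ) N, HasDerivAt (hB (tauN N)) _ t := fun t ht ↦
    hasDerivAt_hB (tauN N) (lt_of_lt_of_le hM1 ht.1)
  have hD : ∀ t ∈ Icc (M : ℝ) N, ‖(-(1 + tauN N * I) * npow (1 + tauN N * I + 1) t * (Real.log t : ℂ) -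
      npow (1 + tauN N * I) t * ((t⁻¹ : ℝ) : ℂ)) / (Real.log t : ℂ) ^ 2‖ ≤ DB (tauN N) t := fun t ht ↦
    norm_deriv_hB_le (tauN N) (lt_of_lt_of_le hM1 ht.1)
  have hDanti : AntitoneOn (DB (tauN N)) (Icc (M : ℝ) N) :=
    (DB_antitoneOn (tauN N) hM1).mono fun t ht ↦ ht.1
  have hG : ∀ n ∈ Finset.Ioc M N, ‖powSum (sN N) (N / n)‖ ≤ 1 + Real.log M := fun n hn ↦
    norm_powSum_div_le_log (Finset.mem_Ioc.1 hn).1 (Finset.mem_Ioc.1 hn).2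
  have h1 := norm_sum_sub_integral_stepC_le (G := powSum (sN N)) (norm_powSum_div_le (sN_re N) N)
    hMN hderiv hD hDanti hG
  have h2 := sum_D_le hMN hDanti fun t ht ↦ DB_nonneg (tauN N) (lt_of_lt_of_le hM1 ht.1)
  have h3 := integral_DB_le (tauN N) hM1 (by exact_mod_cast hMN : (M : ℝ) ≤ N)
  have hlogM : 0 ≤ 1 + Real.log M := by
    have := Real.log_pos hM1; linarith
  unfold gB
  refine h1.trans ?_
  rw [deltaB, ← hM]
  exact mul_le_mul_of_nonneg_left (h2.trans (add_le_add le_rfl h3)) (by positivity)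

/-- **`‖∑_{M<n≤N} g_R(n) − ∫_M^N h_R · stepC_{‖S‖}‖ ≤ deltaR N`.** [folklore] -/
theorem norm_sum_gR_sub_integral_le :
    ‖∑ n ∈ Finset.Ioc (Nat.sqrt N) N, gR N n -
        ∫ t in ((Nat.sqrt N : ℕ) : ℝ)..N,
          hR t * stepC (fun m ↦ ((‖powSum (sN N) m‖ : ℝ) : ℂ)) N t‖ ≤ deltaR N := by
  set M := Nat.sqrt N with hM
  have hM1 : (1 : ℝ) < M := one_lt_sqrtR hN
  have hMN : M ≤ N := (sqrt_lt hN).le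
  have hderiv : ∀ t ∈ Icc (M : ℝ) N, HasDerivAt hR _ t := fun t ht ↦
    hasDerivAt_hR (lt_of_lt_of_le hM1 ht.1)
  have hD : ∀ t ∈ Icc (M : ℝ) N,
      ‖((( -(Real.log t + 1) / (t * Real.log t) ^ 2 : ℝ)) : ℂ)‖ ≤ DR t := fun t ht ↦
    norm_deriv_hR_le (lt_of_lt_of_le hM1 ht.1)
  have hDanti : AntitoneOn DR (Icc (M : ℝ) N) := (DR_antitoneOn hM1).mono fun t ht ↦ ht.1
  have hGC : ∀ k : ℕ, ‖((‖powSum (sN N) (N / k)‖ : ℝ) : ℂ)‖ ≤ N := fun k ↦ by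
    rw [Complex.norm_real, norm_norm]; exact norm_powSum_div_le (sN_re N) N k
  have hG : ∀ n ∈ Finset.Ioc M N, ‖((‖powSum (sN N) (N / n)‖ : ℝ) : ℂ)‖ ≤ 1 + Real.log M := by
    intro n hn
    rw [Complex.norm_real, norm_norm]
    exact norm_powSum_div_le_log (Finset.mem_Ioc.1 hn).1 (Finset.mem_Ioc.1 hn).2
  have h1 := norm_sum_sub_integral_stepC_le (G := fun m ↦ ((‖powSum (sN N) m‖ : ℝ) : ℂ)) hGC hMN
    hderiv hD hDanti hG
  have h2 := sum_D_le hMN hDanti fun t ht ↦ DR_nonneg (lt_of_lt_of_le hM1 ht.1)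
  have h3 := integral_DR_le hM1 (by exact_mod_cast hMN : (M : ℝ) ≤ N)
  have hlogM : 0 ≤ 1 + Real.log M := by
    have := Real.log_pos hM1; linarith
  unfold gR
  refine h1.trans ?_
  rw [deltaR, ← hM]
  exact mul_le_mul_of_nonneg_left (h2.trans (add_le_add le_rfl h3)) (by positivity)

end Delta

/-! ## Measurability and integrability helpers -/

/-- A measurable function bounded on `[a, b]` is interval integrable there. [folklore] -/
theorem intervalIntegrable_of_norm_le {f : ℝ → ℝ} (hf : Measurable f) {a b C : ℝ} (hab : a ≤ b)
    (hC : ∀ t ∈ Icc a b, |f t| ≤ C) : IntervalIntegrable f volume a b := by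
  rw [intervalIntegrable_iff_integrableOn_Icc_of_le hab]
  refine Integrable.mono' (integrable_const C) hf.aestronglyMeasurable ?_
  filter_upwards [ae_restrict_mem measurableSet_Icc] with t ht
  rw [Real.norm_eq_abs]; exact hC t ht

/-- `tableEnv` is measurable. [folklore] -/
theorem measurable_tableEnv : Measurable tableEnv := by
  unfold tableEnv
  exact ((Real.continuous_sqrt.measurable).mul (Real.measurable_log.pow_const 2)).div_const _

/-- `sylvEnv` is measurable. [folklore] -/
theorem measurable_sylvEnv : Measurable sylvEnv := by
  unfold sylvEnv
  refine ((measurable_const.mul measurable_id).add (measurable_const.mul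
    Real.continuous_sqrt.measurable)).add ?_
  exact (measurable_const.mul Real.continuous_sqrt.measurable).mul Real.measurable_log

/-- `thetaEnv` is measurable. [folklore] -/
theorem measurable_thetaEnv : Measurable thetaEnv := by
  unfold thetaEnv
  exact Measurable.ite measurableSet_Iic measurable_tableEnv measurable_sylvEnv

/-- `D_B` is measurable (as a total function). [folklore] -/
theorem measurable_DB (τ : ℝ) : Measurable (DB τ) := by
  unfold DB
  exact ((measurable_const.mul Real.measurable_log).add measurable_const).div
    ((measurable_id.pow_const 2).mul (Real.measurable_log.pow_const 2))

/-- `D_R` is measurable. [folklore] -/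
theorem measurable_DR : Measurable DR := by
  unfold DR
  exact (Real.measurable_log.add measurable_const).div
    ((measurable_id.pow_const 2).mul (Real.measurable_log.pow_const 2))

/-- `D_B` is continuous on `[a, b]`, `a > 1`. [folklore] -/
theorem continuousOn_DB (τ : ℝ) {a b : ℝ} (ha : 1 < a) : ContinuousOn (DB τ) (Icc a b) := by
  have ha0 : 0 < a := by linarith
  have hlogc : ContinuousOn Real.log (Icc a b) :=
    Real.continuousOn_log.mono fun t ht ↦ (lt_of_lt_of_le ha0 ht.1).ne'
  have hnum : ContinuousOn (fun t : ℝ ↦ ‖(1 : ℂ) + τ * I‖ * Real.log t + 1) (Icc a b) :=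
    (continuousOn_const.mul hlogc).add continuousOn_const
  have hden : ContinuousOn (fun t : ℝ ↦ t ^ 2 * Real.log t ^ 2) (Icc a b) :=
    (continuousOn_pow 2).mul (hlogc.pow 2)
  refine hnum.div hden fun t ht ↦ ?_
  have ht0 : 0 < t := lt_of_lt_of_le ha0 ht.1
  have := Real.log_pos (lt_of_lt_of_le ha ht.1)
  positivity

/-- `D_R` is continuous on `[a, b]`, `a > 1`. [folklore] -/
theorem continuousOn_DR {a b : ℝ} (ha : 1 < a) : ContinuousOn DR (Icc a b) := by
  have h := continuousOn_DB 0 (b := b) ha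
  have heq : DB 0 = DR := by ext t; simp [DB, DR]
  rwa [heq] at h

/-- The derivative of `h_B` is continuous on `[a, b]`, `a > 1`. [folklore] -/
theorem continuousOn_hB_deriv (τ : ℝ) {a b : ℝ} (ha : 1 < a) :
    ContinuousOn (fun t : ℝ ↦ (-(1 + τ * I) * npow (1 + τ * I + 1) t * (Real.log t : ℂ) -
      npow (1 + τ * I) t * ((t⁻¹ : ℝ) : ℂ)) / (Real.log t : ℂ) ^ 2) (Icc a b) := by
  have ha0 : 0 < a := by linarith
  have hlogc : ContinuousOn (fun t : ℝ ↦ (Real.log t : ℂ)) (Icc a b) :=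
    Complex.continuous_ofReal.comp_continuousOn
      (Real.continuousOn_log.mono fun t ht ↦ (lt_of_lt_of_le ha0 ht.1).ne')
  have hinv : ContinuousOn (fun t : ℝ ↦ ((t⁻¹ : ℝ) : ℂ)) (Icc a b) :=
    Complex.continuous_ofReal.comp_continuousOn
      (continuousOn_inv₀.mono fun t ht ↦ (lt_of_lt_of_le ha0 ht.1).ne')
  refine ContinuousOn.div ?_ (hlogc.pow 2) fun t ht ↦ ?_
  · exact ((continuousOn_const.mul (continuousOn_npow_Icc _ ha0)).mul hlogc).sub
      ((continuousOn_npow_Icc _ ha0).mul hinv)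
  · have := Real.log_pos (lt_of_lt_of_le ha ht.1)
    exact pow_ne_zero 2 (by rw [Ne, Complex.ofReal_eq_zero]; exact this.ne')

/-- The derivative of `h_R` is continuous on `[a, b]`, `a > 1`. [folklore] -/
theorem continuousOn_hR_deriv {a b : ℝ} (ha : 1 < a) :
    ContinuousOn (fun t : ℝ ↦ (((-(Real.log t + 1) / (t * Real.log t) ^ 2 : ℝ)) : ℂ)) (Icc a b) := by
  have ha0 : 0 < a := by linarith
  have hlogc : ContinuousOn Real.log (Icc a b) :=
    Real.continuousOn_log.mono fun t ht ↦ (lt_of_lt_of_le ha0 ht.1).ne'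
  refine Complex.continuous_ofReal.comp_continuousOn ?_
  refine ((hlogc.add continuousOn_const).neg).div ((continuousOn_id.mul hlogc).pow 2) fun t ht ↦ ?_
  have ht0 : 0 < t := lt_of_lt_of_le ha0 ht.1
  have := Real.log_pos (lt_of_lt_of_le ha ht.1)
  positivity

/-! ## The error terms of the prime sums -/

/-- The boundary terms of the two prime sums:
`thetaEnv N/(N log N) + thetaEnv M · ‖S(N/(M+1))‖/((M+1) log(M+1))`. [folklore] -/
def bdry (N : ℕ) : ℝ :=
  thetaEnv N / (N * Real.log N) +
    thetaEnv (Nat.sqrt N) * ‖powSum (sN N) (N / (Nat.sqrt N + 1))‖ /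
      ((Nat.sqrt N + 1) * Real.log (Nat.sqrt N + 1))

/-- The jump sum `J(N) = ∑_{m=2}^{M} thetaEnv(N/m)/(N log(N/m))` (real quotients `N/m`).
[folklore] -/
def Jsum (N : ℕ) : ℝ :=
  ∑ m ∈ Finset.Icc 2 (Nat.sqrt N), thetaEnv ((N : ℝ) / m) / (N * Real.log ((N : ℝ) / m))

/-- The smooth-variation integral of the `B`-side, in the variable `t`. [folklore] -/
def errIntBt (N : ℕ) : ℝ :=
  ∫ t in ((Nat.sqrt N + 1 : ℕ) : ℝ)..N,
    thetaEnv t * (DB (tauN N) t * ‖stepF (powSum (sN N)) N t‖)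

/-- The smooth-variation integral of the `R`-side, in the variable `t`. [folklore] -/
def errIntRt (N : ℕ) : ℝ :=
  ∫ t in ((Nat.sqrt N + 1 : ℕ) : ℝ)..N, thetaEnv t * (DR t * ‖stepF (powSum (sN N)) N t‖)

section Err

variable {N : ℕ} (hN : 360000 ≤ N)
include hN

/-- The envelope applies at all integers `n ≥ M` (`M ≥ 600 ≥ 599`). [folklore] -/
theorem abs_theta_sub_le_env {n : ℕ} (hn : Nat.sqrt N ≤ n) (_hnN : n ≤ N) :
    |θ (n : ℝ) - n| ≤ thetaEnv n :=
  abs_theta_natCast_sub_le (by have := sqrt_ge hN; omega)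

/-- `‖g_B(N)‖ = 1/(N log N)`, hence the first boundary term. [folklore] -/
theorem thetaEnv_mul_norm_gB_top : thetaEnv N * ‖gB N N‖ ≤ thetaEnv N / (N * Real.log N) := by
  have hN1 : (1 : ℝ) < N := by exact_mod_cast (by omega : 1 < N)
  have hN0 : (0 : ℝ) < N := by linarith
  have hlog := log_pos hN
  have h1 : ‖gB N N‖ = 1 / (N * Real.log N) := by
    unfold gB hB
    rw [Nat.div_self (by omega), show powSum (sN N) 1 = 1 by simp [powSum], mul_one, norm_div,
      ← sN_def, norm_npow_of_re_eq_one (sN_re N) hN0, Complex.norm_real, Real.norm_eq_abs,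
      abs_of_pos hlog]
    field_simp
  rw [h1]
  have := thetaEnv_nonneg hN1.le
  exact le_of_eq (by field_simp)

/-- `‖g_B(M+1)‖ = ‖S(N/(M+1))‖/((M+1) log(M+1))`, hence the second boundary term. [folklore] -/
theorem thetaEnv_mul_norm_gB_bot :
    thetaEnv (Nat.sqrt N) * ‖gB N (Nat.sqrt N + 1)‖ ≤
      thetaEnv (Nat.sqrt N) * ‖powSum (sN N) (N / (Nat.sqrt N + 1))‖ /
        ((Nat.sqrt N + 1) * Real.log (Nat.sqrt N + 1)) := by
  set M := Nat.sqrt N with hM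
  have hM1 : (1 : ℝ) < M := one_lt_sqrtR hN
  have hM0 : (0 : ℝ) < (M : ℝ) + 1 := by linarith
  have hlog : 0 < Real.log ((M : ℝ) + 1) := Real.log_pos (by linarith)
  have h1 : ‖gB N (M + 1)‖ = ‖powSum (sN N) (N / (M + 1))‖ / ((M + 1) * Real.log (M + 1)) := by
    unfold gB hB
    push_cast
    rw [norm_mul, norm_div, ← sN_def, norm_npow_of_re_eq_one (sN_re N) hM0, Complex.norm_real,
      Real.norm_eq_abs, abs_of_pos hlog]
    field_simp
  rw [h1]
  exact le_of_eq (by ring)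

omit hN in
/-- The same two boundary terms for the `R`-side (`‖g_R(n)‖ = ‖g_B(n)‖`). [folklore] -/
theorem norm_gR_eq_norm_gB (n : ℕ) (hn : 1 < n) : ‖gR N n‖ = ‖gB N n‖ := by
  have hn0 : (0 : ℝ) < n := by exact_mod_cast (by omega : 0 < n)
  have hlog : 0 < Real.log n := Real.log_pos (by exact_mod_cast hn)
  unfold gR gB hR hB
  rw [norm_mul, norm_mul, Complex.norm_real, Complex.norm_real, norm_norm, norm_div, ← sN_def,
    norm_npow_of_re_eq_one (sN_re N) hn0, Complex.norm_real, Real.norm_eq_abs, Real.norm_eq_abs,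
    abs_of_pos hlog, abs_of_pos (by positivity)]
  rw [mul_inv, div_eq_mul_inv]

/-- Each jump term is at most `thetaEnv(N/m)/(N log(N/m))`: for `2 ≤ m ≤ M` and `k = N/m`,
`thetaEnv k · ‖h_B(k+1)‖/(N/k) ≤ thetaEnv(N/m)/(N log(N/m))` (real `N/m` on the right).
[folklore] -/
theorem jumpTerm_le {m : ℕ} (hm2 : 2 ≤ m) (hmM : m ≤ Nat.sqrt N) :
    thetaEnv ((N / m : ℕ) : ℝ) * ‖hB (tauN N) ((N / m : ℕ) + 1 : ℕ)‖ / ((N / (N / m) : ℕ) : ℝ) ≤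
      thetaEnv ((N : ℝ) / m) / (N * Real.log ((N : ℝ) / m)) := by
  set M := Nat.sqrt N with hM
  set k := N / m with hk
  have hMN : M * M ≤ N := Nat.sqrt_le N
  have hm0 : 0 < m := by omega
  have hmR : (0 : ℝ) < m := by exact_mod_cast hm0
  have hNR : (0 : ℝ) < N := by exact_mod_cast (by omega : 0 < N)
  -- `N/m ≥ M ≥ 600` as reals
  have hq : (M : ℝ) ≤ (N : ℝ) / m := by
    rw [le_div_iff₀ hmR]
    have : (M : ℝ) * m ≤ M * M := by
      exact_mod_cast Nat.mul_le_mul_left M hmM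
    exact this.trans (by exact_mod_cast hMN)
  have hM600 : (600 : ℝ) ≤ M := by exact_mod_cast sqrt_ge hN
  have hq1 : (1 : ℝ) < (N : ℝ) / m := by linarith
  have hlogq : 0 < Real.log ((N : ℝ) / m) := Real.log_pos hq1
  -- `k ≤ N/m < k + 1`, `k ≥ 1`
  have hk1 : 1 ≤ k := (Nat.one_le_div_iff hm0).2 (by
    have := sqrt_ge hN; have : m ≤ N := by nlinarith
    exact this)
  have hkR : (1 : ℝ) ≤ k := by exact_mod_cast hk1
  have hkle : (k : ℝ) ≤ (N : ℝ) / m := Nat.cast_div_le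
  have hklt : (N : ℝ) / m < (k : ℝ) + 1 := by
    have h := Nat.lt_div_mul_add (a := N) hm0
    rw [← hk] at h
    rw [div_lt_iff₀ hmR]
    have : (N : ℝ) < ((k * m + m : ℕ) : ℝ) := by exact_mod_cast h
    push_cast at this
    linarith
  -- `N/(N/m) ≥ m`
  have hdiv : (m : ℝ) ≤ ((N / k : ℕ) : ℝ) := by
    have : m ≤ N / k := (Nat.le_div_iff_mul_le (by omega)).2 (by
      rw [hk, Nat.mul_comm]; exact Nat.div_mul_le_self N m)
    exact_mod_cast this
  -- the norm of `h_B(k+1)`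
  have hk0 : (0 : ℝ) < (((k + 1 : ℕ) : ℕ) : ℝ) := by positivity
  have hlogk : 0 < Real.log (((k + 1 : ℕ) : ℕ) : ℝ) := Real.log_pos (by push_cast; linarith)
  have hnorm : ‖hB (tauN N) ((k + 1 : ℕ) : ℕ)‖ = 1 / ((((k + 1 : ℕ) : ℕ) : ℝ) * Real.log (((k + 1 : ℕ) : ℕ) : ℝ)) := by
    unfold hB
    rw [norm_div, ← sN_def, norm_npow_of_re_eq_one (sN_re N) hk0, Complex.norm_real,
      Real.norm_eq_abs, abs_of_pos hlogk]
    field_simp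
  rw [hnorm]
  push_cast
  -- compare factor by factor
  have hθ : thetaEnv (k : ℝ) ≤ thetaEnv ((N : ℝ) / m) := thetaEnv_le_thetaEnv hkR hkle
  have hθ0 : 0 ≤ thetaEnv (k : ℝ) := thetaEnv_nonneg hkR
  have hlogk' : Real.log ((N : ℝ) / m) ≤ Real.log ((k : ℝ) + 1) :=
    Real.log_le_log (by linarith) hklt.le
  have hden : (N : ℝ) / m * Real.log ((N : ℝ) / m) * m ≤ ((k : ℝ) + 1) * Real.log ((k : ℝ) + 1) *
      ((N / k : ℕ) : ℝ) := by
    exact mul_le_mul (mul_le_mul hklt.le hlogk' hlogq.le (by linarith)) hdiv hmR.le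
      (mul_nonneg (by linarith) (hlogq.le.trans hlogk'))
  have hden0 : 0 < (N : ℝ) / m * Real.log ((N : ℝ) / m) * m :=
    mul_pos (mul_pos (by positivity) hlogq) hmR
  calc thetaEnv (k : ℝ) * (1 / (((k : ℝ) + 1) * Real.log ((k : ℝ) + 1))) / ((N / k : ℕ) : ℝ)
      = thetaEnv (k : ℝ) / (((k : ℝ) + 1) * Real.log ((k : ℝ) + 1) * ((N / k : ℕ) : ℝ)) := by
        field_simp
    _ ≤ thetaEnv ((N : ℝ) / m) / ((N : ℝ) / m * Real.log ((N : ℝ) / m) * m) := by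
        exact div_le_div₀ ((thetaEnv_nonneg hkR).trans hθ) hθ hden0 hden
    _ = thetaEnv ((N : ℝ) / m) / (N * Real.log ((N : ℝ) / m)) := by
        field_simp

/-- **The jump part of the variation of `g_B` is at most `Jsum N`.** [folklore] -/
theorem sum_jump_gB_le :
    ∑ n ∈ Finset.Ico (Nat.sqrt N + 1) N, thetaEnv n *
        (‖hB (tauN N) (n + 1 : ℕ)‖ * ‖powSum (sN N) (N / (n + 1)) - powSum (sN N) (N / n)‖) ≤
      Jsum N := by
  set M := Nat.sqrt N with hM
  -- termwise: the jump size
  have h1 : ∀ n ∈ Finset.Ico (M + 1) N, thetaEnv n *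
      (‖hB (tauN N) (n + 1 : ℕ)‖ * ‖powSum (sN N) (N / (n + 1)) - powSum (sN N) (N / n)‖) ≤
      if N / (n + 1) < N / n then thetaEnv n * ‖hB (tauN N) (n + 1 : ℕ)‖ / ((N / n : ℕ) : ℝ)
        else 0 := by
    intro n hn
    have hn' := Finset.mem_Ico.1 hn
    have hsq : Nat.sqrt N < n := by omega
    have hj := norm_powSum_div_sub_le (sN_re N) hsq
    have hθ0 : 0 ≤ thetaEnv (n : ℝ) := thetaEnv_nonneg (by exact_mod_cast (by omega : 1 ≤ n))
    split_ifs with hjump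
    · rw [if_pos hjump] at hj
      calc thetaEnv n * (‖hB (tauN N) (n + 1 : ℕ)‖ * ‖powSum (sN N) (N / (n + 1)) - powSum (sN N) (N / n)‖)
          ≤ thetaEnv n * (‖hB (tauN N) (n + 1 : ℕ)‖ * (1 / ((N / n : ℕ) : ℝ))) :=
            mul_le_mul_of_nonneg_left (mul_le_mul_of_nonneg_left hj (norm_nonneg _)) hθ0
        _ = _ := by ring
    · rw [if_neg hjump] at hj
      have : ‖powSum (sN N) (N / (n + 1)) - powSum (sN N) (N / n)‖ = 0 :=
        le_antisymm (by simpa using hj) (norm_nonneg _)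
      rw [this]; simp
  refine (Finset.sum_le_sum h1).trans ?_
  rw [← Finset.sum_filter]
  -- reindex the jump points by their block index
  have hF : ∀ n : ℕ, 0 ≤ thetaEnv n * ‖hB (tauN N) (n + 1 : ℕ)‖ / ((N / n : ℕ) : ℝ) := by
    intro n
    rcases Nat.eq_zero_or_pos n with rfl | hn
    · simp
    · exact div_nonneg (mul_nonneg (thetaEnv_nonneg (by exact_mod_cast hn)) (norm_nonneg _))
        (Nat.cast_nonneg _)
  refine (sum_jumps_le (F := fun n ↦ thetaEnv n * ‖hB (tauN N) (n + 1 : ℕ)‖ / ((N / n : ℕ) : ℝ)) hF M N).trans ?_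
  -- termwise bound and enlargement of the range to `Icc 2 M`
  have hsub : Finset.Icc 2 (N / (M + 1)) ⊆ Finset.Icc 2 M := by
    intro m hm
    have hm' := Finset.mem_Icc.1 hm
    have : N / (M + 1) ≤ M := by
      rw [hM]; exact div_le_sqrt_of_sqrt_lt (Nat.lt_succ_self _)
    exact Finset.mem_Icc.2 ⟨hm'.1, hm'.2.trans this⟩
  have hnn : ∀ m ∈ Finset.Icc 2 M, 0 ≤ thetaEnv ((N : ℝ) / m) / (N * Real.log ((N : ℝ) / m)) := by
    intro m hm
    have hm' := Finset.mem_Icc.1 hm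
    have hmR : (0 : ℝ) < m := by exact_mod_cast (by omega : 0 < m)
    have hMN : M * M ≤ N := Nat.sqrt_le N
    have hq : (M : ℝ) ≤ (N : ℝ) / m := by
      rw [le_div_iff₀ hmR]
      have : (M : ℝ) * m ≤ M * M := by exact_mod_cast Nat.mul_le_mul_left M hm'.2
      exact this.trans (by exact_mod_cast hMN)
    have hM600 : (600 : ℝ) ≤ M := by exact_mod_cast sqrt_ge hN
    have := Real.log_pos (by linarith : (1 : ℝ) < N / m)
    have := thetaEnv_nonneg (by linarith : (1 : ℝ) ≤ N / m)
    positivity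
  calc ∑ m ∈ Finset.Icc 2 (N / (M + 1)),
        thetaEnv ((N / m : ℕ) : ℝ) * ‖hB (tauN N) ((N / m : ℕ) + 1 : ℕ)‖ / ((N / (N / m) : ℕ) : ℝ)
      ≤ ∑ m ∈ Finset.Icc 2 (N / (M + 1)), thetaEnv ((N : ℝ) / m) / (N * Real.log ((N : ℝ) / m)) := by
        refine Finset.sum_le_sum fun m hm ↦ ?_
        have hm' := Finset.mem_Icc.1 hm
        exact jumpTerm_le hN hm'.1 (hsub hm |> Finset.mem_Icc.1 |>.2)
    _ ≤ Jsum N := Finset.sum_le_sum_of_subset_of_nonneg hsub fun m hm _ ↦ hnn m hm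

/-- **The smooth part of the variation of `g_B` is at most `errIntBt N`.** [folklore] -/
theorem sum_smooth_gB_le :
    ∑ n ∈ Finset.Ico (Nat.sqrt N + 1) N, thetaEnv n *
        (‖hB (tauN N) (n + 1 : ℕ) - hB (tauN N) n‖ * ‖powSum (sN N) (N / n)‖) ≤ errIntBt N := by
  set M := Nat.sqrt N with hM
  have hM1 : (1 : ℝ) < M := one_lt_sqrtR hN
  have hMN : M + 1 ≤ N := sqrt_lt hN
  have hτ := tauN N
  unfold errIntBt
  refine sum_mul_le_integral_of_le (e := thetaEnv)
    (P := fun t ↦ DB (tauN N) t * ‖stepF (powSum (sN N)) N t‖) hMN ?_ ?_ ?_ ?_ ?_ ?_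
  · -- `c n ≤ ∫_n^{n+1} P`
    intro n hn _
    have hn1 : (1 : ℝ) < n := by
      have : (M : ℝ) + 1 ≤ n := by exact_mod_cast hn
      linarith
    exact norm_sub_mul_le_integral_stepF (powSum (sN N)) N n
      (fun t ht ↦ hasDerivAt_hB (tauN N) (lt_of_lt_of_le hn1 ht.1))
      (continuousOn_hB_deriv (tauN N) hn1)
      (fun t ht ↦ norm_deriv_hB_le (tauN N) (lt_of_lt_of_le hn1 ht.1))
      (continuousOn_DB (tauN N) hn1)
  · intro t ht
    have ht1 : 1 < t := by
      have : (M : ℝ) + 1 ≤ t := by exact_mod_cast ht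
      linarith
    exact mul_nonneg (DB_nonneg _ ht1) (norm_nonneg _)
  · intro n hn t hnt
    have h' : (M : ℝ) + 1 ≤ n := by exact_mod_cast hn
    exact thetaEnv_le_thetaEnv (by linarith) hnt
  · intro n hn
    have h' : (M : ℝ) + 1 ≤ n := by exact_mod_cast hn
    exact thetaEnv_nonneg (by linarith)
  · intro n hn _
    have hnR : (M : ℝ) + 1 ≤ n := by exact_mod_cast hn
    have hn1 : (1 : ℝ) < n := by linarith
    refine intervalIntegrable_of_norm_le ((measurable_thetaEnv.mul ((measurable_DB _).mul
      (measurable_stepF _ N).norm))) (by linarith)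
      (C := thetaEnv ((n : ℝ) + 1) * (DB (tauN N) n * N)) fun t ht ↦ ?_
    have hθ : thetaEnv t ≤ thetaEnv ((n : ℝ) + 1) := thetaEnv_le_thetaEnv (by linarith [ht.1]) ht.2
    have hθ0 : 0 ≤ thetaEnv t := thetaEnv_nonneg (by linarith [ht.1])
    have hD : DB (tauN N) t ≤ DB (tauN N) n :=
      DB_antitoneOn (tauN N) hn1 (self_mem_Ici) (ht.1) ht.1
    have hD0 : 0 ≤ DB (tauN N) t := DB_nonneg _ (by linarith [ht.1])
    have hS := norm_powSum_div_le (sN_re N) N (⌊t⌋₊)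
    show |thetaEnv t * (DB (tauN N) t * ‖stepF (powSum (sN N)) N t‖)| ≤ _
    rw [abs_of_nonneg (mul_nonneg hθ0 (mul_nonneg hD0 (norm_nonneg _)))]
    exact mul_le_mul hθ (mul_le_mul hD hS (norm_nonneg _) (DB_nonneg _ hn1)) (by positivity)
      (thetaEnv_nonneg (by linarith))
  · intro n hn _
    have hnR : (M : ℝ) + 1 ≤ n := by exact_mod_cast hn
    have hn1 : (1 : ℝ) < n := by linarith
    refine intervalIntegrable_of_norm_le (((measurable_DB _).mul (measurable_stepF _ N).norm))
      (by linarith) (C := DB (tauN N) n * N) fun t ht ↦ ?_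
    have hD : DB (tauN N) t ≤ DB (tauN N) n :=
      DB_antitoneOn (tauN N) hn1 (self_mem_Ici) (ht.1) ht.1
    have hD0 : 0 ≤ DB (tauN N) t := DB_nonneg _ (by linarith [ht.1])
    have hS := norm_powSum_div_le (sN_re N) N (⌊t⌋₊)
    show |DB (tauN N) t * ‖stepF (powSum (sN N)) N t‖| ≤ _
    rw [abs_of_nonneg (mul_nonneg hD0 (norm_nonneg _))]
    exact mul_le_mul hD hS (norm_nonneg _) (DB_nonneg _ hn1)

/-- **The `B`-side prime-sum error**: `‖primeSumErr g_B M N‖ ≤ bdry N + Jsum N + errIntBt N`.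
[folklore] -/
theorem norm_primeSumErr_gB_le :
    ‖primeSumErr (gB N) (Nat.sqrt N) N‖ ≤ bdry N + Jsum N + errIntBt N := by
  set M := Nat.sqrt N with hM
  have hMN : M ≤ N := (sqrt_lt hN).le
  have h0 := norm_primeSumErr_le (gB N) (e := fun n : ℕ ↦ thetaEnv n)
    (fun n h1 h2 ↦ abs_theta_sub_le_env hN h1 h2) hMN
  have h1 := thetaEnv_mul_norm_gB_top hN
  have h2 := thetaEnv_mul_norm_gB_bot hN
  -- the variation
  have hvar : ∑ n ∈ Finset.Ico (M + 1) N, thetaEnv n * ‖gB N (n + 1) - gB N n‖ ≤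
      Jsum N + errIntBt N := by
    have hsplit : ∀ n ∈ Finset.Ico (M + 1) N, thetaEnv n * ‖gB N (n + 1) - gB N n‖ ≤
        thetaEnv n * (‖hB (tauN N) (n + 1 : ℕ)‖ * ‖powSum (sN N) (N / (n + 1)) - powSum (sN N) (N / n)‖) +
        thetaEnv n * (‖hB (tauN N) (n + 1 : ℕ) - hB (tauN N) n‖ * ‖powSum (sN N) (N / n)‖) := by
      intro n hn
      have hθ0 : 0 ≤ thetaEnv (n : ℝ) :=
        thetaEnv_nonneg (by have := (Finset.mem_Ico.1 hn).1; exact_mod_cast (by omega : 1 ≤ n))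
      have := norm_sub_mul_le (fun t : ℝ ↦ hB (tauN N) t) (powSum (sN N)) N n
      unfold gB
      push_cast at this ⊢
      nlinarith [this, hθ0]
    refine (Finset.sum_le_sum hsplit).trans ?_
    rw [Finset.sum_add_distrib]
    exact add_le_add (sum_jump_gB_le hN) (sum_smooth_gB_le hN)
  unfold bdry
  rw [← hM] at *
  linarith [h0, h1, h2, hvar]

/-- The `R`-side jump and smooth parts coincide with (are bounded like) the `B`-side ones with
`h_R` in place of `h_B`; the jump of `‖S‖` is at most the jump of `S`. [folklore] -/
theorem sum_jump_gR_le :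
    ∑ n ∈ Finset.Ico (Nat.sqrt N + 1) N, thetaEnv n *
        (‖hR (n + 1 : ℕ)‖ * ‖(((‖powSum (sN N) (N / (n + 1))‖ : ℝ) : ℂ)) -
          ((‖powSum (sN N) (N / n)‖ : ℝ) : ℂ)‖) ≤ Jsum N := by
  refine le_trans (Finset.sum_le_sum fun n hn ↦ ?_) (sum_jump_gB_le hN)
  have hn' := Finset.mem_Ico.1 hn
  have hn1 : 1 < n + 1 := by omega
  have hθ0 : 0 ≤ thetaEnv (n : ℝ) := thetaEnv_nonneg (by exact_mod_cast (by omega : 1 ≤ n))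
  have hh : ‖hR (n + 1 : ℕ)‖ = ‖hB (tauN N) (n + 1 : ℕ)‖ := by
    have hn0 : (0 : ℝ) < ((n + 1 : ℕ) : ℝ) := by positivity
    have hlog : 0 < Real.log ((n + 1 : ℕ) : ℝ) := Real.log_pos (by exact_mod_cast hn1)
    unfold hR hB
    rw [norm_div, ← sN_def, norm_npow_of_re_eq_one (sN_re N) hn0, Complex.norm_real,
      Complex.norm_real, Real.norm_eq_abs, Real.norm_eq_abs, abs_of_pos hlog,
      abs_of_pos (by positivity), mul_inv, div_eq_mul_inv]
  rw [hh, ← Complex.ofReal_sub, Complex.norm_real]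
  refine mul_le_mul_of_nonneg_left (mul_le_mul_of_nonneg_left ?_ (norm_nonneg _)) hθ0
  exact abs_norm_sub_norm_le _ _

/-- The smooth part of the `R`-side is at most `errIntRt N`. [folklore] -/
theorem sum_smooth_gR_le :
    ∑ n ∈ Finset.Ico (Nat.sqrt N + 1) N, thetaEnv n *
        (‖hR (n + 1 : ℕ) - hR n‖ * ‖(((‖powSum (sN N) (N / n)‖ : ℝ) : ℂ))‖) ≤ errIntRt N := by
  set M := Nat.sqrt N with hM
  have hM1 : (1 : ℝ) < M := one_lt_sqrtR hN
  have hMN : M + 1 ≤ N := sqrt_lt hN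
  have hstepF : ∀ t, ‖stepF (fun m ↦ (((‖powSum (sN N) m‖ : ℝ) : ℂ))) N t‖ =
      ‖stepF (powSum (sN N)) N t‖ := by
    intro t; simp [stepF]
  unfold errIntRt
  refine sum_mul_le_integral_of_le (e := thetaEnv)
    (P := fun t ↦ DR t * ‖stepF (powSum (sN N)) N t‖) hMN ?_ ?_ ?_ ?_ ?_ ?_
  · intro n hn _
    have hn1 : (1 : ℝ) < n := by
      have : (M : ℝ) + 1 ≤ n := by exact_mod_cast hn
      linarith
    have := norm_sub_mul_le_integral_stepF (fun m ↦ (((‖powSum (sN N) m‖ : ℝ) : ℂ))) N n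
      (fun t ht ↦ hasDerivAt_hR (lt_of_lt_of_le hn1 ht.1))
      (continuousOn_hR_deriv hn1)
      (fun t ht ↦ norm_deriv_hR_le (lt_of_lt_of_le hn1 ht.1))
      (continuousOn_DR hn1)
    simpa only [hstepF] using this
  · intro t ht
    have ht1 : 1 < t := by
      have : (M : ℝ) + 1 ≤ t := by exact_mod_cast ht
      linarith
    exact mul_nonneg (DR_nonneg ht1) (norm_nonneg _)
  · intro n hn t hnt
    have h' : (M : ℝ) + 1 ≤ n := by exact_mod_cast hn
    exact thetaEnv_le_thetaEnv (by linarith) hnt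
  · intro n hn
    have h' : (M : ℝ) + 1 ≤ n := by exact_mod_cast hn
    exact thetaEnv_nonneg (by linarith)
  · intro n hn _
    have hnR : (M : ℝ) + 1 ≤ n := by exact_mod_cast hn
    have hn1 : (1 : ℝ) < n := by linarith
    refine intervalIntegrable_of_norm_le ((measurable_thetaEnv.mul (measurable_DR.mul
      (measurable_stepF _ N).norm))) (by linarith)
      (C := thetaEnv ((n : ℝ) + 1) * (DR n * N)) fun t ht ↦ ?_
    have hθ : thetaEnv t ≤ thetaEnv ((n : ℝ) + 1) := thetaEnv_le_thetaEnv (by linarith [ht.1]) ht.2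
    have hθ0 : 0 ≤ thetaEnv t := thetaEnv_nonneg (by linarith [ht.1])
    have hD : DR t ≤ DR n := DR_antitoneOn hn1 (self_mem_Ici) (ht.1) ht.1
    have hD0 : 0 ≤ DR t := DR_nonneg (by linarith [ht.1])
    have hS := norm_powSum_div_le (sN_re N) N (⌊t⌋₊)
    show |thetaEnv t * (DR t * ‖stepF (powSum (sN N)) N t‖)| ≤ _
    rw [abs_of_nonneg (mul_nonneg hθ0 (mul_nonneg hD0 (norm_nonneg _)))]
    exact mul_le_mul hθ (mul_le_mul hD hS (norm_nonneg _) (DR_nonneg hn1)) (by positivity)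
      (thetaEnv_nonneg (by linarith))
  · intro n hn _
    have hnR : (M : ℝ) + 1 ≤ n := by exact_mod_cast hn
    have hn1 : (1 : ℝ) < n := by linarith
    refine intervalIntegrable_of_norm_le ((measurable_DR.mul (measurable_stepF _ N).norm))
      (by linarith) (C := DR n * N) fun t ht ↦ ?_
    have hD : DR t ≤ DR n := DR_antitoneOn hn1 (self_mem_Ici) (ht.1) ht.1
    have hD0 : 0 ≤ DR t := DR_nonneg (by linarith [ht.1])
    have hS := norm_powSum_div_le (sN_re N) N (⌊t⌋₊)
    show |DR t * ‖stepF (powSum (sN N)) N t‖| ≤ _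
    rw [abs_of_nonneg (mul_nonneg hD0 (norm_nonneg _))]
    exact mul_le_mul hD hS (norm_nonneg _) (DR_nonneg hn1)

/-- **The `R`-side prime-sum error**: `‖primeSumErr g_R M N‖ ≤ bdry N + Jsum N + errIntRt N`.
[folklore] -/
theorem norm_primeSumErr_gR_le :
    ‖primeSumErr (gR N) (Nat.sqrt N) N‖ ≤ bdry N + Jsum N + errIntRt N := by
  set M := Nat.sqrt N with hM
  have hMN : M ≤ N := (sqrt_lt hN).le
  have hM600 := sqrt_ge hN
  have h0 := norm_primeSumErr_le (gR N) (e := fun n : ℕ ↦ thetaEnv n)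
    (fun n h1 h2 ↦ abs_theta_sub_le_env hN h1 h2) hMN
  have h1 : thetaEnv N * ‖gR N N‖ ≤ thetaEnv N / (N * Real.log N) := by
    rw [norm_gR_eq_norm_gB N (by omega)]; exact thetaEnv_mul_norm_gB_top hN
  have h2 : thetaEnv M * ‖gR N (M + 1)‖ ≤ thetaEnv M * ‖powSum (sN N) (N / (M + 1))‖ /
      ((M + 1) * Real.log (M + 1)) := by
    rw [norm_gR_eq_norm_gB (M + 1) (by omega)]
    exact thetaEnv_mul_norm_gB_bot hN
  have hvar : ∑ n ∈ Finset.Ico (M + 1) N, thetaEnv n * ‖gR N (n + 1) - gR N n‖ ≤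
      Jsum N + errIntRt N := by
    have hsplit : ∀ n ∈ Finset.Ico (M + 1) N, thetaEnv n * ‖gR N (n + 1) - gR N n‖ ≤
        thetaEnv n * (‖hR (n + 1 : ℕ)‖ * ‖(((‖powSum (sN N) (N / (n + 1))‖ : ℝ) : ℂ)) -
          ((‖powSum (sN N) (N / n)‖ : ℝ) : ℂ)‖) +
        thetaEnv n * (‖hR (n + 1 : ℕ) - hR n‖ * ‖(((‖powSum (sN N) (N / n)‖ : ℝ) : ℂ))‖) := by
      intro n hn
      have hθ0 : 0 ≤ thetaEnv (n : ℝ) :=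
        thetaEnv_nonneg (by have := (Finset.mem_Ico.1 hn).1; exact_mod_cast (by omega : 1 ≤ n))
      have := norm_sub_mul_le (fun t : ℝ ↦ hR t) (fun m ↦ (((‖powSum (sN N) m‖ : ℝ) : ℂ))) N n
      unfold gR
      push_cast at this ⊢
      nlinarith [this, hθ0]
    refine (Finset.sum_le_sum hsplit).trans ?_
    rw [Finset.sum_add_distrib]
    exact add_le_add (sum_jump_gR_le hN) (sum_smooth_gR_le hN)
  unfold bdry
  rw [← hM] at *
  linarith [h0, h1, h2, hvar]

end Err

/-! ## The integrals in the variable `u = log t / log N` -/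

/-- `u_M = log M / log N`. [folklore] -/
def uM (N : ℕ) : ℝ := Real.log (Nat.sqrt N) / Real.log N

/-- `u_{M+1} = log (M+1) / log N`. [folklore] -/
def uM1 (N : ℕ) : ℝ := Real.log ((Nat.sqrt N : ℝ) + 1) / Real.log N

/-- **The main term of `B`**:
`(1 − e^{−iX})/(iτ) + c₀(s) − ∫_{u_M}^1 e^{−iXu} S(N/⌈N^u⌉)/u du`. [folklore] -/
def mainB (N : ℕ) : ℂ :=
  (1 - Complex.exp (-((shiftX : ℝ) : ℂ) * I)) / ((tauN N : ℂ) * I) + emConst (sN N) -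
    ∫ u in (uM N)..1, Complex.exp (-((shiftX * u : ℝ) : ℂ) * I) / (u : ℂ) *
      stepC (powSum (sN N)) N (Real.exp (u * Real.log N))

/-- **The main term of `R`**: `∫_{u_M}^1 ‖S(N/⌈N^u⌉)‖/u du`. [folklore] -/
def mainR (N : ℕ) : ℝ :=
  ∫ u in (uM N)..1, ‖stepC (powSum (sN N)) N (Real.exp (u * Real.log N))‖ / u

/-- The smooth-variation integral of the `B`-side in the variable `u`:
`∫_{u_{M+1}}^1 thetaEnv(N^u) N^{-u} (‖s‖ u L + 1)/(u² L) ‖S(N/⌊N^u⌋)‖ du`. [folklore] -/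
def errIntB (N : ℕ) : ℝ :=
  ∫ u in (uM1 N)..1, thetaEnv (Real.exp (u * Real.log N)) * Real.exp (-(u * Real.log N)) *
    ((‖(1 : ℂ) + tauN N * I‖ * (u * Real.log N) + 1) / (u ^ 2 * Real.log N)) *
      ‖stepF (powSum (sN N)) N (Real.exp (u * Real.log N))‖

/-- The smooth-variation integral of the `R`-side in the variable `u`:
`∫_{u_{M+1}}^1 thetaEnv(N^u) N^{-u} (u L + 1)/(u² L) ‖S(N/⌊N^u⌋)‖ du`. [folklore] -/
def errIntR (N : ℕ) : ℝ :=
  ∫ u in (uM1 N)..1, thetaEnv (Real.exp (u * Real.log N)) * Real.exp (-(u * Real.log N)) *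
    ((u * Real.log N + 1) / (u ^ 2 * Real.log N)) *
      ‖stepF (powSum (sN N)) N (Real.exp (u * Real.log N))‖

/-- The Euler–Maclaurin loss at `S(N)`: `1/(2N) + ‖s(s+1)‖/(16N²)`. [folklore] -/
def tinyB (N : ℕ) : ℝ := 1 / (2 * N) + ‖sN N * (sN N + 1)‖ / (16 * (N : ℝ) ^ 2)

/-- **Change of variables `t = e^{uL}`, real-valued version** (companion of
`integral_comp_exp_mul`). [folklore] -/
theorem integral_comp_exp_mul_real (g : ℝ → ℝ) {L a b : ℝ} (hL : 0 < L) (hab : a ≤ b) :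
    ∫ t in (Real.exp (a * L))..(Real.exp (b * L)), g t =
      ∫ u in a..b, (L * Real.exp (u * L)) * g (Real.exp (u * L)) := by
  set f : ℝ → ℝ := fun u ↦ Real.exp (u * L) with hf
  set f' : ℝ → ℝ := fun u ↦ L * Real.exp (u * L) with hf'
  have hderiv : ∀ x, HasDerivAt f (f' x) x := by
    intro x
    have h1 : HasDerivAt (fun u : ℝ ↦ u * L) L x := by simpa using (hasDerivAt_id x).mul_const L
    have h2 := h1.exp
    simp only [hf, hf']
    convert h2 using 1
    ring
  have hcont : ContinuousOn f (Icc a b) := fun x _ ↦ (hderiv x).continuousAt.continuousWithinAt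
  have hpos : ∀ x ∈ Ioo a b, 0 ≤ f' x := fun x _ ↦ by positivity
  have hmain := MeasureTheory.integral_Icc_deriv_smul_of_deriv_nonneg (g := g) hcont
    (fun x _ ↦ hderiv x) hpos hab
  have hexp : Real.exp (a * L) ≤ Real.exp (b * L) :=
    Real.exp_le_exp.2 (mul_le_mul_of_nonneg_right hab hL.le)
  rw [intervalIntegral.integral_of_le hexp, intervalIntegral.integral_of_le hab,
    ← MeasureTheory.integral_Icc_eq_integral_Ioc, ← MeasureTheory.integral_Icc_eq_integral_Ioc,
    ← hmain]
  refine setIntegral_congr_fun measurableSet_Icc fun u _ ↦ ?_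
  simp only [hf', hf, smul_eq_mul]

/-- The `B`-kernel after substitution: `L e^{uL} h_B(e^{uL}) = e^{−iτLu}/u` (`u, L ≠ 0`).
[folklore] -/
theorem mul_hB_exp (τ : ℝ) {L u : ℝ} (hL : L ≠ 0) (hu : u ≠ 0) :
    ((L * Real.exp (u * L) : ℝ) : ℂ) * hB τ (Real.exp (u * L)) =
      Complex.exp (-((τ * L * u : ℝ) : ℂ) * I) / (u : ℂ) := by
  unfold hB npow
  rw [Real.log_exp]
  have e1 : Complex.exp ((u * L : ℝ) : ℂ) * Complex.exp (-((1 + τ * I) * ((u * L : ℝ) : ℂ))) =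
      Complex.exp (-((τ * L * u : ℝ) : ℂ) * I) := by
    rw [← Complex.exp_add]
    congr 1
    push_cast
    ring
  have hu' : (u : ℂ) ≠ 0 := Complex.ofReal_ne_zero.2 hu
  have hL' : (L : ℂ) ≠ 0 := Complex.ofReal_ne_zero.2 hL
  calc ((L * Real.exp (u * L) : ℝ) : ℂ) * (Complex.exp (-((1 + τ * I) * ((u * L : ℝ) : ℂ))) /
        ((u * L : ℝ) : ℂ))
      = (L : ℂ) * (Complex.exp ((u * L : ℝ) : ℂ) * Complex.exp (-((1 + τ * I) * ((u * L : ℝ) : ℂ)))) /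
          ((u * L : ℝ) : ℂ) := by push_cast; ring
    _ = (L : ℂ) * Complex.exp (-((τ * L * u : ℝ) : ℂ) * I) / ((u * L : ℝ) : ℂ) := by rw [e1]
    _ = Complex.exp (-((τ * L * u : ℝ) : ℂ) * I) / (u : ℂ) := by
        push_cast
        field_simp

/-- The `R`-kernel after substitution: `L e^{uL} h_R(e^{uL}) = 1/u` (`u, L ≠ 0`). [folklore] -/
theorem mul_hR_exp {L u : ℝ} (hL : L ≠ 0) (hu : u ≠ 0) :
    ((L * Real.exp (u * L) : ℝ) : ℂ) * hR (Real.exp (u * L)) = ((u⁻¹ : ℝ) : ℂ) := by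
  unfold hR
  rw [Real.log_exp, ← Complex.ofReal_mul]
  congr 1
  have := Real.exp_pos (u * L)
  field_simp

/-- The variation weight after substitution:
`L e^{uL} D_B(e^{uL}) = e^{−uL} (‖s‖ u L + 1)/(u² L)` (`u, L ≠ 0`). [folklore] -/
theorem mul_DB_exp (τ : ℝ) {L u : ℝ} (hL : L ≠ 0) (hu : u ≠ 0) :
    L * Real.exp (u * L) * DB τ (Real.exp (u * L)) =
      Real.exp (-(u * L)) * ((‖(1 : ℂ) + τ * I‖ * (u * L) + 1) / (u ^ 2 * L)) := by
  unfold DB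
  rw [Real.log_exp, Real.exp_neg]
  have := Real.exp_pos (u * L)
  field_simp

/-- `L e^{uL} D_R(e^{uL}) = e^{−uL} (u L + 1)/(u² L)`. [folklore] -/
theorem mul_DR_exp {L u : ℝ} (hL : L ≠ 0) (hu : u ≠ 0) :
    L * Real.exp (u * L) * DR (Real.exp (u * L)) = Real.exp (-(u * L)) * ((u * L + 1) / (u ^ 2 * L)) := by
  unfold DR
  rw [Real.log_exp, Real.exp_neg]
  have := Real.exp_pos (u * L)
  field_simp

section Subst

variable {N : ℕ} (hN : 360000 ≤ N)
include hN

/-- `u_M · L = log M`, `e^{u_M L} = M`. [folklore] -/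
theorem exp_uM_mul_log : Real.exp (uM N * Real.log N) = Nat.sqrt N := by
  have hL := log_pos hN
  have hM : (0 : ℝ) < Nat.sqrt N := by linarith [one_lt_sqrtR hN]
  unfold uM
  rw [div_mul_cancel₀ _ hL.ne', Real.exp_log hM]

/-- `e^{u_{M+1} L} = M + 1`. [folklore] -/
theorem exp_uM1_mul_log : Real.exp (uM1 N * Real.log N) = (Nat.sqrt N : ℝ) + 1 := by
  have hL := log_pos hN
  have hM : (0 : ℝ) < (Nat.sqrt N : ℝ) + 1 := by linarith [one_lt_sqrtR hN]
  unfold uM1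
  rw [div_mul_cancel₀ _ hL.ne', Real.exp_log hM]

/-- `e^{1 · L} = N`. [folklore] -/
theorem exp_one_mul_log : Real.exp (1 * Real.log N) = N := by
  rw [one_mul, Real.exp_log (by exact_mod_cast (by omega : 0 < N))]

/-- `0 < u_M ≤ 1`. [folklore] -/
theorem uM_pos : 0 < uM N :=
  div_pos (Real.log_pos (one_lt_sqrtR hN)) (log_pos hN)

/-- `u_M ≤ 1`. [folklore] -/
theorem uM_le_one : uM N ≤ 1 := by
  unfold uM
  rw [div_le_one (log_pos hN)]
  exact Real.log_le_log (by linarith [one_lt_sqrtR hN]) (by exact_mod_cast (sqrt_lt hN).le)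

/-- `0 < u_{M+1}`. [folklore] -/
theorem uM1_pos : 0 < uM1 N :=
  div_pos (Real.log_pos (by linarith [one_lt_sqrtR hN])) (log_pos hN)

/-- `u_{M+1} ≤ 1`. [folklore] -/
theorem uM1_le_one : uM1 N ≤ 1 := by
  unfold uM1
  rw [div_le_one (log_pos hN)]
  refine Real.log_le_log (by linarith [one_lt_sqrtR hN]) ?_
  exact_mod_cast (sqrt_lt hN : Nat.sqrt N + 1 ≤ N)

/-- **The `B` step integral in `u`**:
`∫_M^N h_B · stepC_S = ∫_{u_M}^1 e^{−iXu}/u · S(N/⌈N^u⌉) du`. [folklore] -/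
theorem integral_hB_stepC_eq :
    ∫ t in ((Nat.sqrt N : ℕ) : ℝ)..N, hB (tauN N) t * stepC (powSum (sN N)) N t =
      ∫ u in (uM N)..1, Complex.exp (-((shiftX * u : ℝ) : ℂ) * I) / (u : ℂ) *
        stepC (powSum (sN N)) N (Real.exp (u * Real.log N)) := by
  have hL := log_pos hN
  have h := integral_comp_exp_mul (fun t ↦ hB (tauN N) t * stepC (powSum (sN N)) N t) hL
    (uM_le_one hN)
  rw [exp_uM_mul_log hN, exp_one_mul_log hN] at h
  rw [h]
  refine intervalIntegral.integral_congr fun u hu ↦ ?_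
  rw [uIcc_of_le (uM_le_one hN)] at hu
  have hu0 : u ≠ 0 := (lt_of_lt_of_le (uM_pos hN) hu.1).ne'
  rw [← mul_assoc, mul_hB_exp (tauN N) hL.ne' hu0, tauN_mul_log hN]

/-- **The `R` step integral in `u`**: `∫_M^N h_R · stepC_{‖S‖} = mainR N` (as complex numbers).
[folklore] -/
theorem integral_hR_stepC_eq :
    ∫ t in ((Nat.sqrt N : ℕ) : ℝ)..N, hR t * stepC (fun m ↦ ((‖powSum (sN N) m‖ : ℝ) : ℂ)) N t =
      ((mainR N : ℝ) : ℂ) := by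
  have hL := log_pos hN
  have h := integral_comp_exp_mul (fun t ↦ hR t * stepC (fun m ↦ ((‖powSum (sN N) m‖ : ℝ) : ℂ)) N t)
    hL (uM_le_one hN)
  rw [exp_uM_mul_log hN, exp_one_mul_log hN] at h
  rw [h, mainR, ← intervalIntegral.integral_ofReal]
  refine intervalIntegral.integral_congr fun u hu ↦ ?_
  rw [uIcc_of_le (uM_le_one hN)] at hu
  have hu0 : u ≠ 0 := (lt_of_lt_of_le (uM_pos hN) hu.1).ne'
  simp only [stepC]
  rw [← mul_assoc, mul_hR_exp hL.ne' hu0]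
  push_cast
  ring

/-- **The `B` variation integral in `u`**: `errIntBt N = errIntB N`. [folklore] -/
theorem errIntBt_eq : errIntBt N = errIntB N := by
  have hL := log_pos hN
  unfold errIntBt errIntB
  have h := integral_comp_exp_mul_real
    (fun t ↦ thetaEnv t * (DB (tauN N) t * ‖stepF (powSum (sN N)) N t‖)) hL (uM1_le_one hN)
  push_cast at h ⊢
  rw [exp_uM1_mul_log hN, exp_one_mul_log hN] at h
  rw [h]
  refine intervalIntegral.integral_congr fun u hu ↦ ?_
  rw [uIcc_of_le (uM1_le_one hN)] at hu
  have hu0 : u ≠ 0 := (lt_of_lt_of_le (uM1_pos hN) hu.1).ne'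
  have := mul_DB_exp (tauN N) hL.ne' hu0
  calc Real.log N * Real.exp (u * Real.log N) * (thetaEnv (Real.exp (u * Real.log N)) *
        (DB (tauN N) (Real.exp (u * Real.log N)) * ‖stepF (powSum (sN N)) N (Real.exp (u * Real.log N))‖))
      = thetaEnv (Real.exp (u * Real.log N)) * (Real.log N * Real.exp (u * Real.log N) *
          DB (tauN N) (Real.exp (u * Real.log N))) * ‖stepF (powSum (sN N)) N (Real.exp (u * Real.log N))‖ := by
        ring
    _ = _ := by rw [this]; ring

end Subst

section Final

variable {N : ℕ} (hN : 360000 ≤ N)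
include hN

/-- **The `R` variation integral in `u`**: `errIntRt N = errIntR N`. [folklore] -/
theorem errIntRt_eq : errIntRt N = errIntR N := by
  have hL := log_pos hN
  unfold errIntRt errIntR
  have h := integral_comp_exp_mul_real
    (fun t ↦ thetaEnv t * (DR t * ‖stepF (powSum (sN N)) N t‖)) hL (uM1_le_one hN)
  push_cast at h ⊢
  rw [exp_uM1_mul_log hN, exp_one_mul_log hN] at h
  rw [h]
  refine intervalIntegral.integral_congr fun u hu ↦ ?_
  rw [uIcc_of_le (uM1_le_one hN)] at hu
  have hu0 : u ≠ 0 := (lt_of_lt_of_le (uM1_pos hN) hu.1).ne'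
  have := mul_DR_exp hL.ne' hu0
  calc Real.log N * Real.exp (u * Real.log N) * (thetaEnv (Real.exp (u * Real.log N)) *
        (DR (Real.exp (u * Real.log N)) * ‖stepF (powSum (sN N)) N (Real.exp (u * Real.log N))‖))
      = thetaEnv (Real.exp (u * Real.log N)) * (Real.log N * Real.exp (u * Real.log N) *
          DR (Real.exp (u * Real.log N))) * ‖stepF (powSum (sN N)) N (Real.exp (u * Real.log N))‖ := by
        ring
    _ = _ := by rw [this]; ring

/-- `N^{-iτ} = e^{−iX}`: `npow (s − 1) N = exp(−iX)`. [folklore] -/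
theorem npow_sub_one_natCast : npow (sN N - 1) N = Complex.exp (-((shiftX : ℝ) : ℂ) * I) := by
  rw [sN_sub_one, npow, ← tauN_mul_log hN]
  congr 1
  push_cast
  ring

/-- **The decomposition of `B(N)`**:
`B(N) = mainB N + N^{-s}/2 + ρ_N − (∑ g_B − ∫ h_B·stepC) − primeSumErr g_B M N`. [folklore] -/
theorem Bval_eq :
    Bval N = mainB N + npow (sN N) N / 2 + emTail (sN N) N -
      (∑ n ∈ Finset.Ioc (Nat.sqrt N) N, gB N n -
        ∫ t in ((Nat.sqrt N : ℕ) : ℝ)..N, hB (tauN N) t * stepC (powSum (sN N)) N t) -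
      primeSumErr (gB N) (Nat.sqrt N) N := by
  have hM1 : 1 ≤ Nat.sqrt N := by have := sqrt_ge hN; omega
  have hMN : Nat.sqrt N < N := sqrt_lt hN
  have hN1 : 1 ≤ N := by omega
  have hprime := sum_primes_mul_log_eq (gB N) hM1 hMN
  have hEM := powSum_eq_powInt_add (sN_re N) hN1
  have hInt : powInt (sN N) N = (1 - Complex.exp (-((shiftX : ℝ) : ℂ) * I)) / ((tauN N : ℂ) * I) := by
    rw [powInt_eq (sN_ne_one hN) (by exact_mod_cast hN1), npow_sub_one_natCast hN, sN_sub_one]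
  unfold Bval mainB
  rw [sum_bigPrimes_eq_gB, bigPrimes, hprime, hEM, hInt, integral_hB_stepC_eq hN]
  ring

/-- **The analytic upper bound for `‖B(N)‖`** (`N ≥ 360000`):
`‖B(N)‖ ≤ ‖mainB N‖ + tinyB N + deltaB N + bdry N + Jsum N + errIntB N`. [folklore] -/
theorem norm_Bval_le :
    ‖Bval N‖ ≤ ‖mainB N‖ + tinyB N + deltaB N + bdry N + Jsum N + errIntB N := by
  have hN1 : 1 ≤ N := by omega
  have hNR : (0 : ℝ) < N := by exact_mod_cast (by omega : 0 < N)
  rw [Bval_eq hN]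
  have h1 : ‖npow (sN N) N / 2‖ = 1 / (2 * N) := by
    rw [norm_div, norm_npow_of_re_eq_one (sN_re N) hNR]
    simp
    ring
  have h2 : ‖emTail (sN N) N‖ ≤ ‖sN N * (sN N + 1)‖ / (16 * (N : ℝ) ^ 2) := norm_emTail_le (sN_re N) hN1
  have h3 := norm_sum_gB_sub_integral_le hN
  have h4 := norm_primeSumErr_gB_le hN
  rw [errIntBt_eq hN] at h4
  have htiny : ‖npow (sN N) N / 2‖ + ‖emTail (sN N) N‖ ≤ tinyB N := by
    rw [tinyB, h1]; linarith
  have key : ∀ a b c d e : ℂ, ‖a + b + c - d - e‖ ≤ ‖a‖ + ‖b‖ + ‖c‖ + ‖d‖ + ‖e‖ := by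
    intro a b c d e
    calc ‖a + b + c - d - e‖ ≤ ‖a + b + c - d‖ + ‖e‖ := norm_sub_le _ _
      _ ≤ ‖a + b + c‖ + ‖d‖ + ‖e‖ := by gcongr; exact norm_sub_le _ _
      _ ≤ ‖a‖ + ‖b‖ + ‖c‖ + ‖d‖ + ‖e‖ := by gcongr; exact norm_add₃_le
  refine (key _ _ _ _ _).trans ?_
  linarith [htiny, h3, h4]

/-- **The analytic lower bound for `R(N)`** (`N ≥ 360000`):
`R(N) ≥ mainR N − deltaR N − bdry N − Jsum N − errIntR N`. [folklore] -/
theorem Rval_ge : mainR N - deltaR N - bdry N - Jsum N - errIntR N ≤ Rval N := by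
  have hM1 : 1 ≤ Nat.sqrt N := by have := sqrt_ge hN; omega
  have hMN : Nat.sqrt N < N := sqrt_lt hN
  have hprime := sum_primes_mul_log_eq (gR N) hM1 hMN
  set Δ := ∑ n ∈ Finset.Ioc (Nat.sqrt N) N, gR N n -
    ∫ t in ((Nat.sqrt N : ℕ) : ℝ)..N, hR t * stepC (fun m ↦ ((‖powSum (sN N) m‖ : ℝ) : ℂ)) N t
    with hΔ
  set err := primeSumErr (gR N) (Nat.sqrt N) N with herr
  have hR : ((Rval N : ℝ) : ℂ) = ((mainR N : ℝ) : ℂ) + Δ + err := by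
    rw [Rval_eq_gR, bigPrimes, hprime, hΔ, ← integral_hR_stepC_eq hN]
    ring
  have hre := congrArg Complex.re hR
  simp only [Complex.ofReal_re, Complex.add_re] at hre
  have h1 := norm_sum_gR_sub_integral_le hN
  have h2 := norm_primeSumErr_gR_le hN
  rw [errIntRt_eq hN] at h2
  rw [← hΔ] at h1
  have l1 : -‖Δ‖ ≤ Δ.re := (abs_le.1 (Complex.abs_re_le_norm Δ)).1
  have l2 : -‖err‖ ≤ err.re := (abs_le.1 (Complex.abs_re_le_norm err)).1
  linarith

end Final

end TuranShift

end Literature.Barriers.RiemannHypothesis
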